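import Summits.ValiantsHypothesis.ValiantsHypothesis.Theses.GrenetZeon
import Literature.Computability.AlgebraicComplexity.AlgDetRepr

/-!
# Skeleton line `zeon-window` for the piece `AbelianizationQP` (stmt-ValiantsHypothesis-8063)
# of the decomposition `AlgDcQP ⇐ TransferToDc ∧ AbelianizationQP ∧ PolySizeQPAlgebra`

`AbelianizationQP`: `∃ c`, every affine determinantal representation of `per_n` (`n ≥ 1`) of size
`m` yields an `(n^c + c, 2^((log₂ m + c)^c))`-representation (polynomial matrix size, commuting
coefficients of quasi-polynomial dimension in `m`).

Line: the statement splits along the ZEON THRESHOLD `n ≤ (log₂ m + c)^c`.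
* `stub_zeonPoint` — above the threshold nothing about the given representation is used: the zeon
  point `(n, 2^n)` (per_n = top coefficient of `det diag(Σ_j x_ij z_j)` over `ℂ[z]/(z_i²)`;
  Glynn 2010, Brand–Dell–Husfeldt 2018 §3; = support item `ZeonPoint`, stmt-8066, in
  `HasAlgDetRepr` form) padded by monotonicity gives the representation outright.
* `stub_subexpAbelianization` — THE CONTENT: below the threshold, i.e. for determinantal
  representations of SUBEXPONENTIAL size `m < 2^(n^{1/c})` (where `2^((log₂ m + c)^c) < 2^n` and no
  universal coding fits), the representation itself must be abelianized.  Known instances: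
  Grenet's `2^n - 1` ↦ zeons `(n, 2^n)`, Landsberg–Ressayre's `C(2n,n) - 1` ↦ the apolar algebra
  of `det_n`, both with `s ≈ m`.  By Mignon–Ressayre the window is `n²/2 ≤ m < 2^(n^{1/c})`; it is
  EMPTY (and the stub vacuous) iff `dc(per_n) ≥ 2^(n^{1/c})` — so the stub is implied by an
  exponential-type lower bound and is otherwise a genuine structural claim about subexponential
  determinantal expressions of the permanent (general form: lens `strengthen`, idea card
  `general-abelianization`).
* `AbelianizationQP_of` — composition (proved): case split at the threshold; `HasAlgDetRepr.mono`.
-/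

noncomputable section

set_option linter.dupNamespace false

namespace Summit.ValiantsHypothesis.ValiantsHypothesis.Cruxes.AbelianizationQP.ZeonWindow

open MvPolynomial Matrix
open Literature.Computability.AlgebraicComplexity
open Summit.ValiantsHypothesis.ValiantsHypothesis.Theses.GrenetZeon

/-- **Stub 1 (the zeon point, `HasAlgDetRepr` form of support item `ZeonPoint` stmt-8066).**
For `n ≥ 1`, `per_n` is `λ (det_n diag(L_1, …, L_n))` over the zeon algebra
`R = ℂ[z_1, …, z_n]/(z_i²)` (`dim R = 2^n`), `L_i = Σ_j x_ij z_j`, `λ` = coefficient of `z_1 ⋯ z_n`: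
repeated columns die, permutations survive with coefficient `1`. Glynn 2010; Brand–Dell–Husfeldt
2018, §3. Size: M (construction: `R = ⨂_i DualNumber ℂ` or `MvPolynomial (Fin n) ℂ ⧸ (X_i^2)`). -/
theorem stub_zeonPoint (n : ℕ) (hn : 1 ≤ n) : HasAlgDetRepr (perPoly (Fin n) ℂ) n (2 ^ n) := by
  sorry

/-- **Stub 2 (abelianization below the zeon threshold — the content of the piece).** There is
`c ≥ 1` such that for `n ≥ 1` and `(log₂ m + c)^c < n`, every affine determinantal representation of
`per_n` of size `m` yields an `(n^c + c, 2^((log₂ m + c)^c))`-representation.  The window is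
`n²/2 ≤ m < 2^(n^{1/c})` (Mignon–Ressayre floor); it is empty iff `dc(per_n) ≥ 2^(n^{1/c})`.
Conjecture-grade (Grenet 2011 / Landsberg–Ressayre 2017 are the abelianizable instances known;
Nisan 1991 and Hrubeš–Yehudayoff 2011 Thm. 3.4 are why a generic noncommutative transition
structure might resist). Size: open. -/
theorem stub_subexpAbelianization :
    ∃ c : ℕ, 1 ≤ c ∧ ∀ n m : ℕ, 1 ≤ n → (Nat.log 2 m + c) ^ c < n →
      HasDetRepr (perPoly (Fin n) ℂ) m →
        HasAlgDetRepr (perPoly (Fin n) ℂ) (n ^ c + c) (2 ^ ((Nat.log 2 m + c) ^ c)) := by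
  sorry

/-- **Composition (proved): `AbelianizationQP` from the two stubs** — above the threshold pad the
zeon point (`n ≤ n^c + c`, `2^n ≤ 2^((log₂ m + c)^c)`), below it use the window stub. -/
theorem AbelianizationQP_of : AbelianizationQP := by
  obtain ⟨c, hc, h⟩ := stub_subexpAbelianization
  refine ⟨c, fun n m hn hdet => ?_⟩
  by_cases hw : (Nat.log 2 m + c) ^ c < n
  · exact h n m hn hw hdet
  · push Not at hw
    exact (stub_zeonPoint n hn).mono
      ((Nat.le_self_pow (by omega) n).trans (Nat.le_add_right _ _))
      (Nat.pow_le_pow_right (by norm_num) hw)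

end Summit.ValiantsHypothesis.ValiantsHypothesis.Cruxes.AbelianizationQP.ZeonWindow
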